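import Literature.Analysis.FluidPDE.GKPCriticalElements
import Literature.Analysis.FunctionSpaces.CheminLerner
import HarnessLib

/-!
# GKP (1.9) with (1.6) and Gallagher–Koch–Planchon's solution class `𝓛^{1:∞}_{p,q}[T' < T]`

Sibling file of `Literature/Analysis/FluidPDE/GKPCriticalElements.lean`, which vendors GKP's (1.9)
("`T*(u₀)` is independent of `p` and `q` for any `p, q ∈ (3, ∞)`", Gallagher–Koch–Planchon 2016,
p. 4) together with (1.6) as the named fact `Literature.Analysis.FluidPDE.gkp_regularity_persistence`,
stated for the tree's class `IsBesovMildSolutionOn` (duality-form mild solution, continuous in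
`Ḃ^{s_p}_{p,q}` through its distributions, Kato's class `K_∞`: `sup_{0<τ<t} √τ ‖u(τ)‖_∞ < ∞`,
`√t ‖u(t)‖_∞ → 0`). This file is the outcome of the attempt to *discharge* that fact; it records,
inside the tree, why the fact is not derivable from its source as stated, defines GKP's own
solution class (`MemGKPPathSpace`), and proves the bookkeeping implication
`gkp_regularity_persistence_of_pathSpace` isolating the missing ingredient. Everything here is a
definition or a proved theorem; no named fact is added and nothing in `GKPCriticalElements.lean`
is changed.

## Faithfulness audit of `gkp_regularity_persistence`

In print, (1.6) and (1.9) are statements about `NS(u₀)`, *the unique solution of the Duhamel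
equation (1.2) in the Chemin–Lerner path space* `X_T = 𝓛^{1:∞}_{p,q}(T) = L̃¹([0,T]; Ḃ^{s_p+2}_{p,q}) ∩
L̃^∞([0,T]; Ḃ^{s_p}_{p,q})` (GKP 2016, (1.3), (1.5), (1.6); the maximal time in (1.9) is
`T*_{𝓛^{1:∞}_{p,q}(T)}(u₀)`). The fact `gkp_regularity_persistence` instead quantifies over every member of
`IsBesovMildSolutionOn`, which follows from the printed statements only if that class is a
uniqueness class (equivalently, is contained in `𝓛^{1:∞}_{p,q}[T' < T]`). This identification is a
design assumption of `CriticalRegularity.lean` ("Kato's class … in which mild solutions are unique"),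
not a published theorem, and the literature cautions against it:

* continuity in the critical Besov space alone is **not** a uniqueness class: for `3 < p ≤ ∞` and
  every `1 ≤ q ≤ ∞` there are infinitely many mild solutions in `C([0,T); Ḃ^{3/p-1}_{p,q}(ℝ³))` from the
  datum `0` (Fujii 2026, Thm. 1.2 (N2); his Remark 1.3: no contradiction with Chemin/Planchon, whose
  class is `C_t Ḃ ∩ L̃¹_t Ḃ^{s_p+2}`, i.e. GKP's `𝓛^{1:∞}`); [cite: Fujii2026, Thm. 1.2]
* every printed uniqueness theorem for such rough classes uses an `L²`-in-time integrability at
  `t = 0` that Kato's `K_∞` (where `∫₀ᵗ (t-s)^{-1/2} s^{-1} ds = ∞`) does not supply: Kato 1984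
  (`K_q`, `q < ∞`), Koch–Tataru 2001 (the Carleson part of `E_T`), Miura 2005, Thm. 2.3 (uniqueness in
  `C([0,T); bmo⁻¹) ∩ L^∞_loc((0,T); L^∞)` for mild solutions *in `L²(0,T; L²_uloc)`*).
  [cite: Miura2005, Thm. 2.3]

Hence `gkp_regularity_persistence` is stated for a wider class than its source supports, and even
under the identification its discharge is the whole local Cauchy theory of (NS) in
`Ḃ^{s_p}_{p,q} ∩ Ḃ^{s_{p'}}_{p',q'}` (paraproduct and Chemin–Lerner heat estimates, fixed point,
uniqueness, continuation; Gallagher–Iftimie–Planchon 2003).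

## The corrected statement (for a later `definition` proposal; not vendored here, D-0026)

With `MemGKPPathSpace p q T U := ∀ T' ∈ (0, T), ‖U‖_{𝓛^{1:∞}_{p,q}(0,T')} < ∞` (below), the faithful
rendering of (1.9) with (1.6) adds the path-space clause to hypothesis **and** conclusion:

    ∀ {ν}, 0 < ν → ∀ {p q p' q'} [Fact (1 ≤ p)] [Fact (1 ≤ p')], 3 < p → p < ∞ → 3 < q → q < ∞ →
      3 < p' → p' < ∞ → 3 < q' → q' < ∞ → ∀ {T}, 0 < T → ∀ {u U},
      IsBesovMildSolutionOn (-1 + 3 / p'.toReal) p' q' T ν u U → MemGKPPathSpace p' q' T U →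
      MemHomBesov (-1 + 3 / p.toReal) p q (U 0) →
      IsBesovMildSolutionOn (-1 + 3 / p.toReal) p q T ν u U ∧ MemGKPPathSpace p q T U

(hypothesis `h` of `gkp_regularity_persistence_of_pathSpace`, verbatim). The theorem
`gkp_regularity_persistence_of_pathSpace` shows that the vendored fact is this corrected statement
**plus** the identification "every `IsBesovMildSolutionOn` solution lies in `𝓛^{1:∞}[T' < T]`"
(hypothesis `hId`), which is exactly the unprinted ingredient.

## References

* I. Gallagher, G. S. Koch, F. Planchon, *Blow-up of critical Besov norms at a potential
  Navier–Stokes singularity*, Comm. Math. Phys. 343 (2016) 39–82 = arXiv:1407.4156, p. 4: (1.2),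
  (1.3), (1.5), (1.6), (1.9); Rem. 1.3. Equation numbers here and in `GKPCriticalElements.lean`
  follow the CMP version; in the arXiv version (the held copy) the path spaces `𝓛^{a:b}_{p,q}` are
  (1.6), the uniqueness statement is (1.7) and the exponent-independence of `T*` is (1.10)
  (arXiv numbering: (1.6)/(1.7)/(1.10) for CMP (1.5)/(1.6)/(1.9)). [cite: GKP2016, (1.9) and (1.6)]
* M. Fujii, *Sharp non-uniqueness for the Navier–Stokes equations in scaling critical spaces*,
  arXiv:2602.19846 (2026), Prop. 1.1, Thm. 1.2, Rem. 1.3.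
* H. Miura, *Remark on uniqueness of mild solutions to the Navier–Stokes equations*, J. Funct.
  Anal. 218 (2005) 110–129, Thm. 2.3.
* I. Gallagher, D. Iftimie, F. Planchon, Ann. Inst. Fourier 53 (2003) 1387–1424 (propagation of
  regularity, the reference behind (1.9)).
-/

noncomputable section

open MeasureTheory TemperedDistribution Set Function Filter Topology
open scoped SchwartzMap ENNReal NNReal

namespace Literature.Analysis.FluidPDE

/-- Local notation for physical space `ℝ³ = EuclideanSpace ℝ (Fin 3)`. -/
local notation "ℝ³" => EuclideanSpace ℝ (Fin 3)

/-- Local notation for the complexified target `ℂ³ = EuclideanSpace ℂ (Fin 3)`. -/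
local notation "ℂ³" => EuclideanSpace ℂ (Fin 3)

/-! ## GKP's path-space class `𝓛^{1:∞}_{p,q}[T' < T]` -/

section PathSpace

/-- **Membership in GKP's path space up to (not including) time `T`**:
`U ∈ 𝓛^{1:∞}_{p,q}[T' < T]`, i.e. `‖U‖_{𝓛^{1:∞}_{p,q}(0,T')} < ∞` for every `0 < T' < T`, where
`𝓛^{1:∞}_{p,q}(0,T') = L̃¹((0,T'); Ḃ^{s_p+2}_{p,q}) ∩ L̃^∞((0,T'); Ḃ^{s_p}_{p,q})` is normed by
`Literature.Analysis.FunctionSpaces.eGKPPathNorm 1 ∞ p q 0 T'` (Gallagher–Koch–Planchon 2016, (1.5) and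
Rem. 1.3: "`u ∈ 𝓛^{a:b}_{p,q}[T < T*]` merely means that `u ∈ 𝓛^{a:b}_{p,q}(T)` for each fixed
`T < T*`"). This is the class `X_T` in which `NS(u₀)` exists and is unique ((1.3), (1.6)).
[cite: GKP2016, (1.5)] -/
def MemGKPPathSpace (p q : ℝ≥0∞) [Fact (1 ≤ p)] (T : ℝ) (U : ℝ → 𝓢'(ℝ³, ℂ³)) : Prop :=
  ∀ T' ∈ Ioo 0 T, FunctionSpaces.eGKPPathNorm 1 ∞ p q 0 T' U < ∞

/-- Unfolding `MemGKPPathSpace`. [cite: GKP2016, (1.5)] -/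
theorem memGKPPathSpace_iff {p q : ℝ≥0∞} [Fact (1 ≤ p)] {T : ℝ} {U : ℝ → 𝓢'(ℝ³, ℂ³)} :
    MemGKPPathSpace p q T U ↔ ∀ T' ∈ Ioo 0 T, FunctionSpaces.eGKPPathNorm 1 ∞ p q 0 T' U < ∞ :=
  Iff.rfl

/-- `𝓛^{1:∞}[T' < T]` is monotone in `T` (restriction to a shorter interval; GKP 2016, Rem. 1.3).
[cite: GKP2016, Rem. 1.3] -/
theorem MemGKPPathSpace.mono {p q : ℝ≥0∞} [Fact (1 ≤ p)] {T T₁ : ℝ} {U : ℝ → 𝓢'(ℝ³, ℂ³)}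
    (h : MemGKPPathSpace p q T U) (hT : T₁ ≤ T) : MemGKPPathSpace p q T₁ U :=
  fun T' hT' => h T' ⟨hT'.1, hT'.2.trans_le hT⟩

/-- A path with finite `𝓛^{1:∞}_{p,q}(0,T)` norm on the whole interval lies in `𝓛^{1:∞}[T' < T]`
(monotonicity of the Chemin–Lerner norms in the time set; GKP 2016, Rem. 1.3: the converse fails,
"the notation does not imply any uniform control as `T ↗ T*`"). [cite: GKP2016, Rem. 1.3] -/
theorem memGKPPathSpace_of_lt_top {p q : ℝ≥0∞} [Fact (1 ≤ p)] {T : ℝ} {U : ℝ → 𝓢'(ℝ³, ℂ³)}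
    (h : FunctionSpaces.eGKPPathNorm 1 ∞ p q 0 T U < ∞) : MemGKPPathSpace p q T U :=
  fun _ hT' => (FunctionSpaces.eGKPPathNorm_mono le_rfl hT'.2.le U).trans_lt h

/-- The zero path lies in every `𝓛^{1:∞}[T' < T]`. [cite: GKP2016, (1.5)] -/
theorem memGKPPathSpace_zero (p q : ℝ≥0∞) [Fact (1 ≤ p)] (T : ℝ) :
    MemGKPPathSpace p q T (0 : ℝ → 𝓢'(ℝ³, ℂ³)) :=
  fun _ _ => by simp

end PathSpace

/-! ## What separates the vendored fact from the printed (1.9) with (1.6) -/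

section Glue

/-- **`gkp_regularity_persistence` = (1.9) with (1.6) in GKP's class + the identification of the
tree's class with `NS(u₀)`.** Hypothesis `h` is the corrected (faithful) form of GKP 2016, (1.9)
with (1.6): for a Besov mild solution `(u, U)` on `[0, T)` in the class `(s_{p'}, p', q')` **lying in
`𝓛^{1:∞}_{p',q'}[T' < T]`** (hence equal to `NS(u₀)` on every `[0, T']` by the uniqueness (1.6)) whose
initial distribution lies in `Ḃ^{s_p}_{p,q}`, `T ≤ T*(u₀)` is independent of the exponents ((1.9)) and
`(u, U) = NS(u₀)` is a Besov mild solution in the class `(s_p, p, q)` lying in `𝓛^{1:∞}_{p,q}[T' < T]`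
((1.6)), all exponents in `(3, ∞)`. Hypothesis `hId` is the standing identification of
`CriticalRegularity.lean` — every `IsBesovMildSolutionOn` solution (duality-form mild,
`C([0,T); Ḃ^{s_p}_{p,q})`, Kato's class `K_∞`) lies in GKP's path space — which is **not** a published
result (see the module docstring) and is not asserted here. Together they give
`gkp_regularity_persistence` exactly as vendored in `GKPCriticalElements.lean`; the proof is
bookkeeping. [cite: GKP2016, (1.9) and (1.6)] -/
theorem gkp_regularity_persistence_of_pathSpace
    (h : ∀ ⦃ν : ℝ⦄, 0 < ν → ∀ ⦃p q p' q' : ℝ≥0∞⦄ [Fact (1 ≤ p)] [Fact (1 ≤ p')], 3 < p → p < ∞ →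
      3 < q → q < ∞ → 3 < p' → p' < ∞ → 3 < q' → q' < ∞ → ∀ ⦃T : ℝ⦄, 0 < T →
      ∀ ⦃u : ℝ → ℝ³ → ℝ³⦄ ⦃U : ℝ → 𝓢'(ℝ³, ℂ³)⦄,
        IsBesovMildSolutionOn (-1 + 3 / p'.toReal) p' q' T ν u U → MemGKPPathSpace p' q' T U →
        FunctionSpaces.MemHomBesov (-1 + 3 / p.toReal) p q (U 0) →
        IsBesovMildSolutionOn (-1 + 3 / p.toReal) p q T ν u U ∧ MemGKPPathSpace p q T U)
    (hId : ∀ ⦃ν : ℝ⦄, 0 < ν → ∀ ⦃p q : ℝ≥0∞⦄ [Fact (1 ≤ p)], 3 < p → p < ∞ → 3 < q → q < ∞ →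
      ∀ ⦃T : ℝ⦄, 0 < T → ∀ ⦃u : ℝ → ℝ³ → ℝ³⦄ ⦃U : ℝ → 𝓢'(ℝ³, ℂ³)⦄,
        IsBesovMildSolutionOn (-1 + 3 / p.toReal) p q T ν u U → MemGKPPathSpace p q T U) :
    gkp_regularity_persistence := by
  intro ν hν p q p' q' _ _ hp₃ hp hq₃ hq hp'₃ hp' hq'₃ hq' T hT u U hu hU0
  exact (h hν hp₃ hp hq₃ hq hp'₃ hp' hq'₃ hq' hT hu (hId hν hp'₃ hp' hq'₃ hq' hT hu) hU0).1

end Glue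

end Literature.Analysis.FluidPDE
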